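import Mathlib
import HarnessLib

/-!
# `(φ − 1)² T ⊆ pT ⇒ (φ^{pⁿ} − 1) T ⊆ pⁿ (φ − 1) T` — the operator lemma behind Perrin-Riou's
# condition (**) — file C0a of THEOREM C of row T-DER (the congruence; cell `b2b-bsdres`, team
# n1011, seat p11 GEN 8, OWNERS row T-DER = skel/T-DER.md STATUS v8)

HONEST FRAMING (cell `b2b-bsdres`, run/shared/lean/b2b/bsd-rank1-residual/, verbatim in every
file): the goal of the cell is to DELETE the COMBINATION-SHAPED residual classes of the
Birch–Swinnerton-Dyer formula for ALL analytic-rank `≤ 1` elliptic curves over `ℚ` — "full BSD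
formula for every rank `≤ 1` curve in class `C`" assembled STRICTLY from published theorems — so
that the rank-`≤ 1` remainder becomes exactly the CONSTRUCTION-SHAPED classes, which are TYPED
(missing-input `Prop`s), NOT attempted. This is not "finishing BSD". Team n1011: research route on
the CONSTRUCTION-SHAPED class X4 / §I N11 (route-1 PORT, (P-DER)); TOOL theorems of commutative /
linear algebra (no definition, no named fact, no `sorry`); curve-free.

## What and why

THEOREM C of row T-DER ([Rubin00] Thm. 4.5.4, the finite–singular relation of the Kolyvagin
derivative classes) needs, besides the generic cocycle identity (files C1/C2, landed), the
CONGRUENCE `loc_λ c_{rq} = Z_q · loc_λ c_r` in `H¹_f(K(rq)_λ, T) = T/(φ_λ − 1)T` (Kolyvagin's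
second axiom), which B. Perrin-Riou (*Systèmes d'Euler p-adiques et théorie d'Iwasawa*, Ann. Inst.
Fourier 48 (1998), Prop. 2.2.5 (ii), proof p. 1252 (2.2.6)–(2.2.8)) derives from the norm relations
by ASCENDING THE `p`-TOWER to a layer of degree `M = pⁿ` in which `λ` is inert: there the local
Frobenius is `φ_λ^M`, and the room to divide the tame relation by `q − 1` is exactly the inclusion
`(φ_λ^M − 1)T ⊆ (q − 1)(φ_λ − 1)T`, guaranteed by her condition (**) on `φ_λ` (p. 1248: "il existe
`M₀` telle que `(f^{M₀} − 1)T ⊂ p(f − 1)T`", shown there to follow from the nilpotence of `f − 1`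
modulo `p`).  This file proves the operator lemma in the form the ascent (file C0b) consumes, for an
endomorphism `φ` of any module and an odd prime `p`:
* `exists_pow_prime_sub_one_apply_eq` — if `(φ − 1)² T ⊆ pT` then `(φ^p − 1)T ⊆ p(φ − 1)T`
  (binomial theorem for the commuting pair `(φ − 1, 1)`: the middle coefficients are divisible by
  `p`, the last term `(φ−1)^p = (φ−1)^{p−2}(φ−1)²` lands in `p(φ−1)T` because `p ≥ 3`);
* `exists_pow_prime_pow_sub_one_apply_eq` — hence `(φ^{pⁿ} − 1)T ⊆ pⁿ(φ − 1)T` for every `n`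
  (the hypothesis passes from `φ` to `φ^p`);
* `exists_sub_one_sub_one_eq_of_rank_two` — the hypothesis for a rank-two `φ` with
  `φ² − aφ + q = 0`, `p ∣ a − 2`, `p ∣ q − 1`: `(φ − 1)² = (a − 2)φ − (q − 1)`; at a Kolyvagin prime
  `q` for `E[p^k]` (`q ≡ 1`, `a_q ≡ 2 mod p^k`) this is the Frobenius of `T_pE`, and any power
  `φ^f` inherits it (`exists_sub_one_sub_one_eq_pow`).

References: B. Perrin-Riou, Ann. Inst. Fourier 48 (1998) 1231–1307, §2.2.2 (condition (**)),
Prop. 2.2.5; K. Rubin, in LNM 1716 (1999), Prop. 8.6.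
-/

open Finset Function

namespace Summit.BirchSwinnertonDyer.Rank1Residual.GaloisImage

namespace Congruence

variable {A : Type*} [CommRing A] {T : Type*} [AddCommGroup T] [Module A T]

/-- Powers of `φ − 1` beyond the second land in `p · (φ − 1)T` when `(φ − 1)²T ⊆ pT`:
`(φ−1)^{k+3} t ∈ p (φ−1) T`. [folklore] -/
theorem exists_sub_one_pow_add_three_apply_eq (p : ℕ) (φ : Module.End A T)
    (h2 : ∀ t : T, ∃ s : T, (φ - 1) ((φ - 1) t) = p • s) (k : ℕ) (t : T) :
    ∃ s : T, ((φ - 1) ^ (k + 3)) t = p • (φ - 1) s := by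
  obtain ⟨s, hs⟩ := h2 t
  refine ⟨((φ - 1) ^ k) s, ?_⟩
  rw [show k + 3 = (k + 1) + 2 from by ring, pow_add, Module.End.mul_apply, pow_two,
    Module.End.mul_apply, hs, map_nsmul, pow_succ', Module.End.mul_apply]

/-- **`(φ − 1)² T ⊆ pT ⇒ (φ^p − 1) T ⊆ p(φ − 1) T`** for an odd prime `p` (Perrin-Riou's
condition (**), [PerrinRiou1998AIF] §2.2.2 p. 1248, in its sharp one-step form): expand
`φ^p = ((φ − 1) + 1)^p` by the binomial theorem; the terms `C(p,m)(φ−1)^m`, `0 < m < p`, have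
`p ∣ C(p,m)`, and `(φ−1)^p = (φ−1)^{p−3}·(φ−1)·(φ−1)²` lands in `p(φ−1)T` since `p ≥ 3`.
[cite: PerrinRiou1998AIF, §2.2.2 condition (**)] -/
theorem exists_pow_prime_sub_one_apply_eq (p : ℕ) (hp : p.Prime) (hp2 : p ≠ 2)
    (φ : Module.End A T) (h2 : ∀ t : T, ∃ s : T, (φ - 1) ((φ - 1) t) = p • s) (t : T) :
    ∃ s : T, (φ ^ p - 1) t = p • (φ - 1) s := by
  have hp3 : 3 ≤ p := by
    rcases hp.eq_two_or_odd' with h | h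
    · exact absurd h hp2
    · have := hp.two_le; rcases h with ⟨k, rfl⟩; omega
  set N : Module.End A T := φ - 1 with hN
  have hφ : φ = N + 1 := (sub_add_cancel φ 1).symm
  -- binomial expansion of `(N + 1)^p`, the `m = 0` term split off
  have hbin : (N + 1) ^ p = ∑ m ∈ range (p + 1), N ^ m * 1 ^ (p - m) * (p.choose m : Module.End A T) :=
    (Commute.one_right N).add_pow p
  have hsplit : (φ ^ p - 1) t = ∑ m ∈ range p, (p.choose (m + 1)) • (N ^ (m + 1)) t := by
    rw [hφ, hbin, sum_range_succ', LinearMap.sub_apply, LinearMap.add_apply]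
    simp only [one_pow, mul_one, pow_zero, Nat.choose_zero_right, Nat.cast_one,
      Module.End.one_apply, add_sub_cancel_right, LinearMap.sum_apply,
      Module.End.mul_apply, Module.End.natCast_apply, map_nsmul]
  -- each remaining term lies in `p (φ − 1) T`
  have hterm : ∀ m ∈ range p, ∃ s : T, (p.choose (m + 1)) • (N ^ (m + 1)) t = p • N s := by
    intro m hm
    rw [mem_range] at hm
    by_cases hmp : m + 1 < p
    · obtain ⟨c, hc⟩ := hp.dvd_choose_self (Nat.succ_ne_zero m) hmp
      refine ⟨c • (N ^ m) t, ?_⟩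
      rw [hc, mul_smul, map_nsmul, pow_succ', Module.End.mul_apply]
    · have hm1 : m + 1 = p := by omega
      obtain ⟨s, hs⟩ := exists_sub_one_pow_add_three_apply_eq p φ h2 (p - 3) t
      have hp33 : p - 3 + 3 = p := by omega
      rw [hp33] at hs
      refine ⟨s, ?_⟩
      rw [hm1, Nat.choose_self, one_smul]
      exact hs
  choose s hs using hterm
  refine ⟨∑ m ∈ (range p).attach, s m.1 m.2, ?_⟩
  rw [hsplit, map_sum, smul_sum, ← sum_attach]
  exact sum_congr rfl fun m _ => hs m.1 m.2

/-- **`(φ − 1)² T ⊆ pT ⇒ (φ^{pⁿ} − 1) T ⊆ pⁿ(φ − 1) T`** for an odd prime `p` and every `n`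
([PerrinRiou1998AIF] §2.2.2, condition (**) iterated: the hypothesis passes from `φ` to `φ^p`
because `(φ^p − 1)T ⊆ p(φ−1)T ⊆ (φ−1)T`).  This is the inclusion `(φ_λ^M − 1)T ⊆ M(φ_λ − 1)T`,
`M = pⁿ`, that makes room to divide the tame Euler relation by `q − 1` in the layer of the
`p`-tower where `λ` is inert of degree `M` ([PerrinRiou1998AIF] p. 1252, after (2.2.8)).
[cite: PerrinRiou1998AIF, §2.2.2 condition (**) and Prop. 2.2.5 (ii)] -/
theorem exists_pow_prime_pow_sub_one_apply_eq (p : ℕ) (hp : p.Prime) (hp2 : p ≠ 2) (n : ℕ) :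
    ∀ (φ : Module.End A T), (∀ t : T, ∃ s : T, (φ - 1) ((φ - 1) t) = p • s) →
      ∀ t : T, ∃ s : T, (φ ^ (p ^ n) - 1) t = p ^ n • (φ - 1) s := by
  induction n with
  | zero => intro φ _ t; exact ⟨t, by rw [pow_zero, pow_one, one_smul]⟩
  | succ n ih =>
    intro φ h2 t
    -- the hypothesis for `φ^p`
    have h2' : ∀ t : T, ∃ s : T, (φ ^ p - 1) ((φ ^ p - 1) t) = p • s := fun t => by
      obtain ⟨s, hs⟩ := exists_pow_prime_sub_one_apply_eq p hp hp2 φ h2 ((φ ^ p - 1) t)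
      exact ⟨(φ - 1) s, hs⟩
    obtain ⟨s, hs⟩ := ih (φ ^ p) h2' t
    obtain ⟨s', hs'⟩ := exists_pow_prime_sub_one_apply_eq p hp hp2 φ h2 s
    refine ⟨s', ?_⟩
    rw [pow_succ', pow_mul, hs, hs', smul_smul, mul_comm]

/-- The same with an arbitrary exponent `p^n ∣ m`-free form used downstream: membership version.
If `(φ − 1)²T ⊆ pT` then for every `t` there is `s` with `(φ^{pⁿ} − 1) t = (φ − 1) (pⁿ • s)`.
[folklore] -/
theorem exists_pow_prime_pow_sub_one_apply_eq' (p : ℕ) (hp : p.Prime) (hp2 : p ≠ 2) (n : ℕ)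
    (φ : Module.End A T) (h2 : ∀ t : T, ∃ s : T, (φ - 1) ((φ - 1) t) = p • s) (t : T) :
    ∃ s : T, (φ ^ (p ^ n) - 1) t = (φ - 1) (p ^ n • s) := by
  obtain ⟨s, hs⟩ := exists_pow_prime_pow_sub_one_apply_eq p hp hp2 n φ h2 t
  exact ⟨s, by rw [hs, map_nsmul]⟩

/-! ### The hypothesis for a rank-two Frobenius at a Kolyvagin prime -/

/-- **`(φ − 1)² T ⊆ pT` for a rank-two `φ`** with `φ² = aφ − q` (Cayley–Hamilton), `p ∣ a − 2` and
`p ∣ q − 1`: indeed `(φ − 1)² = (a − 2)φ − (q − 1)`.  For `T = T_pE` and `φ = Frob_q` at a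
Kolyvagin prime `q` for `E[p^k]` (`q ≡ 1 mod p^k`, `p^k ∣ #E(𝔽_q) = q + 1 − a_q`, so
`a_q ≡ 2 mod p^k`) this is Perrin-Riou's nilpotence "`f − 1` nilpotent sur `T/pT`".
[cite: PerrinRiou1998AIF, §2.2.2] -/
theorem exists_sub_one_sub_one_eq_of_rank_two (p : ℕ) (φ : Module.End A T) (a q : ℤ)
    (hchar : ∀ t : T, φ (φ t) = a • φ t - q • t) (ha : (p : ℤ) ∣ a - 2) (hq : (p : ℤ) ∣ q - 1)
    (t : T) : ∃ s : T, (φ - 1) ((φ - 1) t) = p • s := by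
  obtain ⟨c, hc⟩ := ha
  obtain ⟨d, hd⟩ := hq
  refine ⟨c • φ t - d • t, ?_⟩
  have key : (φ - 1) ((φ - 1) t) = (a - 2) • φ t - (q - 1) • t := by
    simp only [LinearMap.sub_apply, Module.End.one_apply, map_sub, hchar]
    module
  rw [key, hc, hd, ← Nat.cast_smul_eq_nsmul ℤ, smul_sub, smul_smul, smul_smul]

/-- Powers inherit the hypothesis: if `(φ − 1)²T ⊆ pT` then `(φ^f − 1)²T ⊆ pT` for every `f`
(`φ^f − 1 = (φ − 1)·h = h·(φ − 1)` with `h = Σ_{j<f} φ^j` commuting with `φ`). The Frobenius of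
the local field `K(r)_λ` is `Frob_q^f`, `f` the residue degree. [folklore] -/
theorem exists_sub_one_sub_one_eq_pow (p : ℕ) (φ : Module.End A T)
    (h2 : ∀ t : T, ∃ s : T, (φ - 1) ((φ - 1) t) = p • s) (f : ℕ) (t : T) :
    ∃ s : T, (φ ^ f - 1) ((φ ^ f - 1) t) = p • s := by
  set h : Module.End A T := ∑ j ∈ range f, φ ^ j with hh
  have hfac : φ ^ f - 1 = h * (φ - 1) := (geom_sum_mul φ f).symm
  have hfac' : φ ^ f - 1 = (φ - 1) * h := (mul_geom_sum φ f).symm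
  obtain ⟨s, hs⟩ := h2 (h (h t))
  refine ⟨s, ?_⟩
  -- `(φ^f − 1)² t = (φ−1) h (φ−1) h t = (φ−1)(φ−1) h h t`
  have hcomm : h * (φ - 1) = (φ - 1) * h := by rw [← hfac, ← hfac']
  have hcomm' : ∀ x : T, h ((φ - 1) x) = (φ - 1) (h x) := fun x => by
    have e := congrArg (fun F : Module.End A T => F x) hcomm
    simpa only [Module.End.mul_apply] using e
  rw [hfac']
  simp only [Module.End.mul_apply]
  rw [hcomm' (h t), hs]

end Congruence

end Summit.BirchSwinnertonDyer.Rank1Residual.GaloisImage
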